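import Mathlib.Analysis.Complex.Basic
import Mathlib.Data.Matrix.Block
import Mathlib.LinearAlgebra.Matrix.Adjugate
import Mathlib.LinearAlgebra.Matrix.Reindex
import Mathlib.LinearAlgebra.UnitaryGroup
import Literature.Computability.QuantumComplexity.MatchgateSimulation
import Literature.Computability.Cryptography.QubitRegisterProofs
import HarnessLib

/-!
# The Clifford-algebra (Jordan–Wigner) calculus of nearest-neighbour matchgates

Topic `Literature/Computability/QuantumComplexity`, model namespace `Matchgate`. Proof
infrastructure, part I, of the discharge of the named fact `JozsaMiyake2008_thm1`
(`MatchgateSimulation.lean`; sequel files `MatchgateHeisenberg.lean`, `MatchgateNumerics.lean`,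
`MatchgateSimulationProofs.lean`). This file is the OPERATOR ALGEBRA of Jozsa–Miyake 2008, §4–§5:
the Jordan–Wigner representation of the Clifford algebra `C_{2N}` on `N` qubits and their
Theorem 3 ("`U† c_μ U = ∑_ν R_{μν} c_ν` with `R ∈ SO(2n)`") SPECIALISED to the one case Theorem 1
needs — a single allowable `G(A,B)` (`IsMatchgate`) placed on two adjacent wires — written
entirely in the tree's `placeGate` vocabulary. Everything is proved; the only definitions are
proof vocabulary (no named facts).

## Contents

1. Placement calculus (all from `placeGate_apply`): `placeGate_add_mg`, `placeGate_smul_mg`,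
   `placeGate_sum_mg`, `placeGate_conjTranspose_mg`, `placeGate_nested` (placing on wires of a
   placed register; the same statement as `placeGate_placeGate` of
   `ForrelationThm25Amplitude.lean`, re-proved to keep this import cone small), `placeGate_perm`
   (re-ordering the wires of the small register), `signDiag S = ∏_{i∈S} Z_i` and
   `signDiag_mul_placeGate_comm`.
2. `σX, σY, σZ` on `QReg 1`; `wire j`, `blockEmb j : Fin 2 ↪ Fin N` (wires `j, j+1`);
   **`majOp j b`** — the Majorana `c_{2j+1} = Z^{⊗j} X_j` (`b = false`) / `c_{2j+2} = Z^{⊗j} Y_j`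
   (`b = true`) of JM08 eq. (11), 0-based wire `j`; the block reduction `majOp_block` and the
   commutation of a parity-preserving placed block gate with all other Majoranas
   (`placeGate_blockEmb_comm_majOp_of_lt/of_gt`).
3. The `2 × 2` algebra behind Theorem 3 for one `G(A,B)`: in the parity-sorted basis
   (`paritySplit`, `reindex_gateGAB : G(A,B) ↦ A ⊕ B`) the four two-qubit Majoranas are
   `[[0, α], [αᴴ, 0]]` with `α = pauli p ∈ {X, Y, Z, -i·1}` (`reindex_majOp`); the real span of
   these four is `IsAntiQuat M :↔ Mᴴ = -adj M`, preserved by `M ↦ Aᴴ M B` for unitary `A, B` with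
   `det A = det B` (`IsAntiQuat.conj` — where "allowable" enters), whence
   `Aᴴ α_μ B = ∑_ν R_{μν} α_ν` with the REAL orthogonal `R = rot2 A B` (`conjPauli_eq_sum`,
   `rot2_mul_transpose`, via the Pauli expansion and Parseval).
4. `rotOf U`, **`IsMatchgate.conj_majOp`** (`Uᴴ c_μ U = ∑_ν (rotOf U)_{μν} c_ν` on `QReg 2`),
   `IsMatchgate.rotOf_mul_transpose`, `IsMatchgate.mem_unitaryGroup`, `IsMatchgate.mul_zz_comm`
   (parity), `IsMatchgate.submatrix_swap` (`SWAP G(A,B) SWAP = G(A, XBX)` is allowable, JM08 §2).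
5. Majorana indices `MIdx N = Fin N × Bool`, the block embedding `embE j R` of a `4 × 4` matrix
   (identity off the block `{j, j+1} × {X, Y}`), the sparse row update `vecMul_embE_apply`,
   `embE_mul_transpose`, and the bilinear form `zExp` of JM08 eq. (10) on a basis state.

Deviation from print: JM08 prove Theorem 3 for Gaussian operations `e^{iH}` by differentiating
`U(t) c U(t)†` (Lie algebra, §4); the special case needed here is finite `2 × 2` matrix algebra
(item 3), which avoids exponentials. `GaussianRank.majorana` (tensor-product `pauliString` form)
is the same operator in another vocabulary; it is not used here because the interaction with
`placeGate` of a non-product two-qubit gate is what this file is about.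

## References

* R. Jozsa, A. Miyake, *Matchgates and classical simulation of quantum circuits*, Proc. R. Soc. A
  464 (2008) 3089–3106 = arXiv:0804.4050, eq. (1), §2, Thm. 3, §4 eq. (8),(10), §5 eq. (11).
  [JozsaMiyake2008]
* M. A. Nielsen, I. L. Chuang, *Quantum Computation and Quantum Information*, CUP 2010, §4.2–4.3
  (gates on a subset of the wires). [NielsenChuang2010]
-/

namespace Literature.Computability.QuantumComplexity.Matchgate

open Matrix Complex Finset Literature.Computability.Cryptography

variable {k N : ℕ}

/-! ### Placement calculus -/

/-- Placement is additive in the gate. [folklore] -/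
theorem placeGate_add_mg (e : Fin k ↪ Fin N) (U V : Matrix (QReg k) (QReg k) ℂ) :
    placeGate e (U + V) = placeGate e U + placeGate e V := by
  ext x y
  simp only [placeGate_apply, Matrix.add_apply]
  split_ifs <;> simp

/-- Placement commutes with scalars. [folklore] -/
theorem placeGate_smul_mg (e : Fin k ↪ Fin N) (c : ℂ) (U : Matrix (QReg k) (QReg k) ℂ) :
    placeGate e (c • U) = c • placeGate e U := by
  ext x y
  simp only [placeGate_apply, Matrix.smul_apply, smul_eq_mul]
  split_ifs <;> simp

/-- Placing the zero gate gives zero. [folklore] -/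
theorem placeGate_zero_mg (e : Fin k ↪ Fin N) :
    placeGate e (0 : Matrix (QReg k) (QReg k) ℂ) = 0 := by
  ext x y
  simp only [placeGate_apply, Matrix.zero_apply]
  split_ifs <;> rfl

/-- Placement commutes with finite sums. [folklore] -/
theorem placeGate_sum_mg {ι : Type*} (e : Fin k ↪ Fin N) (s : Finset ι)
    (f : ι → Matrix (QReg k) (QReg k) ℂ) :
    placeGate e (∑ i ∈ s, f i) = ∑ i ∈ s, placeGate e (f i) := by
  classical
  induction s using Finset.induction_on with
  | empty => rw [sum_empty, sum_empty, placeGate_zero_mg]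
  | insert a s ha ih => rw [sum_insert ha, sum_insert ha, placeGate_add_mg, ih]

/-- Placement commutes with the conjugate transpose. [folklore] -/
theorem placeGate_conjTranspose_mg (e : Fin k ↪ Fin N) (U : Matrix (QReg k) (QReg k) ℂ) :
    placeGate e Uᴴ = (placeGate e U)ᴴ := by
  ext x y
  simp only [placeGate_apply, conjTranspose_apply]
  by_cases h : ∀ i, i ∉ Set.range e → x i = y i
  · rw [if_pos h, if_pos fun i hi => (h i hi).symm]
  · rw [if_neg h, if_neg fun h' => h fun i hi => (h' i hi).symm, star_zero]

/-- **Iterated placement**: placing on the wires `e` of a register itself placed on the wires `f`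
is placing on the wires `f ∘ e`. [cite: NielsenChuang2010, §4.2] -/
theorem placeGate_nested {m : ℕ} (f : Fin N ↪ Fin m) (e : Fin k ↪ Fin N)
    (U : Matrix (QReg k) (QReg k) ℂ) :
    placeGate f (placeGate e U) = placeGate (e.trans f) U := by
  ext x y
  simp only [placeGate_apply]
  by_cases h : ∀ i, i ∉ Set.range (e.trans f) → x i = y i
  · rw [if_pos h, if_pos, if_pos]
    · rfl
    · intro j hj
      exact h (f j) fun ⟨l, hl⟩ => hj ⟨l, f.injective (by simpa using hl)⟩
    · intro i hi
      exact h i fun ⟨l, hl⟩ => hi ⟨e l, by simpa using hl⟩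
  · rw [if_neg h]
    split_ifs with h1 h2
    · exfalso
      refine h fun i hi => ?_
      by_cases hif : i ∈ Set.range f
      · obtain ⟨j, rfl⟩ := hif
        exact h2 j fun ⟨l, hl⟩ => hi ⟨l, by simp [← hl]⟩
      · exact h1 i hif
    · rfl
    · rfl

/-- **Re-ordering the wires of the placed register**: placing `U` along `e ∘ σ` is placing the
re-indexed gate `U ∘ (σ × σ)` along `e`. [folklore] -/
theorem placeGate_perm (σ : Fin k ≃ Fin k) (e : Fin k ↪ Fin N) (U : Matrix (QReg k) (QReg k) ℂ) :
    placeGate (σ.toEmbedding.trans e) U =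
      placeGate e (U.submatrix (fun x => x ∘ σ) (fun x => x ∘ σ)) := by
  ext x y
  simp only [placeGate_apply, submatrix_apply]
  have hr : Set.range (σ.toEmbedding.trans e) = Set.range e := by
    ext i
    constructor
    · rintro ⟨l, rfl⟩; exact ⟨σ l, rfl⟩
    · rintro ⟨l, rfl⟩; exact ⟨σ.symm l, by simp⟩
  simp only [hr]
  rfl

/-! ### Sign diagonals and their commutation with placed gates -/

/-- The sign of a bit: `(-1)^b`. [folklore] -/
def bsign (b : Bool) : ℂ := if b then -1 else 1

/-- `bsign b ≠ 0`. [folklore] -/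
theorem bsign_mul_self (b : Bool) : bsign b * bsign b = 1 := by
  cases b <;> simp [bsign]

/-- The **sign diagonal** of a set of wires `S`: `|x⟩ ↦ (-1)^{|\{i ∈ S : x_i = 1\}|} |x⟩`, i.e. the
Pauli string `∏_{i ∈ S} Z_i`. [folklore] -/
noncomputable def signDiag (S : Finset (Fin N)) : Matrix (QReg N) (QReg N) ℂ :=
  diagonal fun x => ∏ i ∈ S, bsign (x i)

/-- The empty sign diagonal is the identity. [folklore] -/
@[simp] theorem signDiag_empty : signDiag (∅ : Finset (Fin N)) = 1 := by
  simp [signDiag]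

/-- Sign diagonals of disjoint wire sets multiply to the sign diagonal of the union. [folklore] -/
theorem signDiag_union {S T : Finset (Fin N)} (h : Disjoint S T) :
    signDiag (S ∪ T) = signDiag S * signDiag T := by
  rw [signDiag, signDiag, signDiag, diagonal_mul_diagonal]
  congr 1
  funext x
  rw [prod_union h]

/-- Sign diagonals square to the identity. [folklore] -/
theorem signDiag_mul_self (S : Finset (Fin N)) : signDiag S * signDiag S = 1 := by
  rw [signDiag, diagonal_mul_diagonal, ← diagonal_one]
  congr 1
  funext x
  rw [← prod_mul_distrib]
  exact prod_eq_one fun i _ => bsign_mul_self _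

/-- Sign diagonals are self-adjoint. [folklore] -/
theorem signDiag_conjTranspose (S : Finset (Fin N)) : (signDiag S)ᴴ = signDiag S := by
  rw [signDiag, diagonal_conjTranspose]
  congr 1
  funext x
  rw [Pi.star_apply, star_prod]
  refine prod_congr rfl fun i _ => ?_
  cases x i <;> simp [bsign]

/-- **A sign diagonal supported off the wires of a placed gate commutes with it.**
[cite: NielsenChuang2010, §4.2] -/
theorem signDiag_mul_placeGate_comm {S : Finset (Fin N)} (e : Fin k ↪ Fin N)
    (h : ∀ i ∈ S, i ∉ Set.range e) (U : Matrix (QReg k) (QReg k) ℂ) :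
    signDiag S * placeGate e U = placeGate e U * signDiag S := by
  ext x y
  rw [signDiag, diagonal_mul, mul_diagonal, placeGate_apply]
  split_ifs with hxy
  · rw [mul_comm]
    congr 1
    exact prod_congr rfl fun i hi => by rw [hxy i (h i hi)]
  · simp

/-- The sign diagonal of the wires of an embedding is the placement of the full sign diagonal of
the small register. [folklore] -/
theorem signDiag_map (e : Fin k ↪ Fin N) :
    signDiag (univ.map e) = placeGate e (signDiag (univ : Finset (Fin k))) := by
  ext x y
  rw [signDiag, signDiag, placeGate_apply]
  by_cases hxy : x = y
  · subst hxy
    simp only [diagonal_apply_eq, prod_map, implies_true, if_true]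
    rfl
  · rw [diagonal_apply_ne _ hxy]
    split_ifs with h
    · rw [diagonal_apply_ne]
      intro heq
      exact hxy (funext fun i => by
        by_cases hi : i ∈ Set.range e
        · obtain ⟨j, rfl⟩ := hi; exact congrFun heq j
        · exact h i hi)
    · rfl

/-! ### One-qubit Paulis, wires and blocks -/

/-- Pauli `X` on one qubit. [folklore] -/
def σX : Matrix (QReg 1) (QReg 1) ℂ := Matrix.of fun x y => if x 0 = y 0 then 0 else 1

/-- Pauli `Y = [[0, -i], [i, 0]]` on one qubit (`⟨1|Y|0⟩ = i`). [folklore] -/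
def σY : Matrix (QReg 1) (QReg 1) ℂ :=
  Matrix.of fun x y => if x 0 = y 0 then 0 else if x 0 then I else -I

/-- Pauli `Z = diag(1, -1)` on one qubit. [folklore] -/
noncomputable def σZ : Matrix (QReg 1) (QReg 1) ℂ := diagonal fun x => bsign (x 0)

/-- The Pauli of a Majorana type: `X` for `false`, `Y` for `true`. [folklore] -/
def σ (b : Bool) : Matrix (QReg 1) (QReg 1) ℂ := if b then σY else σX

/-- The embedding `Fin 1 ↪ Fin N` of the single wire `j`. [folklore] -/
def wire (j : Fin N) : Fin 1 ↪ Fin N := ⟨fun _ => j, fun a b _ => Subsingleton.elim a b⟩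

/-- `wire j` selects `j`. [folklore] -/
@[simp] theorem wire_apply (j : Fin N) (i : Fin 1) : wire j i = j := rfl

/-- The range of `wire j` is `{j}`. [folklore] -/
@[simp] theorem range_wire (j : Fin N) : Set.range (wire j) = {j} := by
  ext i; simp [wire, eq_comm]

/-- The embedding `Fin 2 ↪ Fin N` of the two ADJACENT wires `j, j + 1` (in this order).
[cite: JozsaMiyake2008, Thm 1 (i) (nearest-neighbour lines)] -/
def blockEmb (j : ℕ) (h : j + 2 ≤ N) : Fin 2 ↪ Fin N :=
  ⟨fun i => ⟨j + i, by omega⟩, fun a b hab => by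
    apply Fin.ext
    have := congrArg Fin.val hab
    dsimp only at this
    omega⟩

/-- Values of `blockEmb`. [folklore] -/
@[simp] theorem blockEmb_apply_val (j : ℕ) (h : j + 2 ≤ N) (i : Fin 2) :
    ((blockEmb j h i : Fin N) : ℕ) = j + i := rfl

/-- The first wire of a block. [folklore] -/
theorem wire_zero_trans_blockEmb (j : ℕ) (h : j + 2 ≤ N) :
    (wire (0 : Fin 2)).trans (blockEmb j h) = wire ⟨j, by omega⟩ := by
  ext i; simp

/-- The second wire of a block. [folklore] -/
theorem wire_one_trans_blockEmb (j : ℕ) (h : j + 2 ≤ N) :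
    (wire (1 : Fin 2)).trans (blockEmb j h) = wire ⟨j + 1, by omega⟩ := by
  ext i; simp

/-- The set of wires strictly below `j` (the support of the Jordan–Wigner string of wire `j`).
[cite: JozsaMiyake2008, §5 eq. (11)] -/
def wiresBelow (j : ℕ) : Finset (Fin N) := univ.filter fun i => (i : ℕ) < j

/-- Membership in `wiresBelow`. [folklore] -/
@[simp] theorem mem_wiresBelow {j : ℕ} {i : Fin N} : i ∈ (wiresBelow j : Finset (Fin N)) ↔ (i : ℕ) < j := by
  simp [wiresBelow]

/-- No wire lies below `0`. [folklore] -/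
@[simp] theorem wiresBelow_zero : (wiresBelow 0 : Finset (Fin N)) = ∅ := by
  ext i; simp

/-- `wiresBelow (j+1) = wiresBelow j ∪ {j}`. [folklore] -/
theorem wiresBelow_succ (j : Fin N) :
    (wiresBelow ((j : ℕ) + 1) : Finset (Fin N)) = wiresBelow j ∪ {j} := by
  ext i
  simp only [mem_wiresBelow, mem_union, mem_singleton]
  constructor
  · intro h
    rcases Nat.lt_succ_iff_lt_or_eq.1 h with h | h
    · exact Or.inl h
    · exact Or.inr (Fin.ext h)
  · rintro (h | rfl)
    · exact Nat.lt_succ_of_lt h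
    · exact Nat.lt_succ_self _

/-! ### Majorana operators -/

/-- **The Jordan–Wigner Majorana operators** (JM08 eq. (11), 0-based wire `j`):
`majOp j false = Z_0 ⋯ Z_{j-1} X_j = c_{2j+1}` and `majOp j true = Z_0 ⋯ Z_{j-1} Y_j = c_{2j+2}`,
as `2^N × 2^N` matrices in the tree's conventions (`placeGate`, rows = output label).
[cite: JozsaMiyake2008, §5 eq. (11)] -/
noncomputable def majOp (j : Fin N) (b : Bool) : Matrix (QReg N) (QReg N) ℂ :=
  signDiag (wiresBelow j) * placeGate (wire j) (σ b)

/-- The JW string below `j` is supported off the wire `j`. [folklore] -/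
theorem wiresBelow_not_mem_range_wire (j : Fin N) :
    ∀ i ∈ (wiresBelow (j : ℕ) : Finset (Fin N)), i ∉ Set.range (wire j) := by
  intro i hi hmem
  rw [range_wire, Set.mem_singleton_iff] at hmem
  rw [mem_wiresBelow, hmem] at hi
  exact lt_irrefl _ hi

/-- `Z` on one qubit is the full sign diagonal of `QReg 1`. [folklore] -/
theorem σZ_eq_signDiag : σZ = signDiag (univ : Finset (Fin 1)) := by
  rw [σZ, signDiag]
  congr 1
  funext x
  rw [Fin.prod_univ_one]

/-- `Z_j` placed on wire `j` is the sign diagonal of `{j}`. [folklore] -/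
theorem placeGate_wire_σZ (j : Fin N) : placeGate (wire j) σZ = signDiag {j} := by
  rw [σZ_eq_signDiag, ← signDiag_map]
  congr 1

/-- **The JW string grows by one `Z`**: `Z_{<j+1} = Z_{<j} · Z_j`. [cite: JozsaMiyake2008, §5 eq. (11)] -/
theorem signDiag_wiresBelow_succ (j : Fin N) :
    signDiag (wiresBelow ((j : ℕ) + 1) : Finset (Fin N)) =
      signDiag (wiresBelow j) * placeGate (wire j) σZ := by
  rw [wiresBelow_succ, signDiag_union, placeGate_wire_σZ]
  exact disjoint_singleton_right.2 fun h => lt_irrefl _ (mem_wiresBelow.1 h)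

/-- `signDiag_wiresBelow_succ` with the wire given by its index. [folklore] -/
theorem signDiag_wiresBelow_succ' (j : ℕ) (hj : j < N) :
    signDiag (wiresBelow (j + 1) : Finset (Fin N)) =
      signDiag (wiresBelow j) * placeGate (wire ⟨j, hj⟩) σZ :=
  signDiag_wiresBelow_succ ⟨j, hj⟩

/-- In a two-qubit register the JW string of wire `0` is trivial: `majOp 0 b = σ_b ⊗ 1`. [folklore] -/
theorem majOp_two_zero (b : Bool) : majOp (0 : Fin 2) b = placeGate (wire 0) (σ b) := by
  rw [majOp, Fin.val_zero, wiresBelow_zero, signDiag_empty, Matrix.one_mul]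

/-- In a two-qubit register `majOp 1 b = Z ⊗ σ_b`. [folklore] -/
theorem majOp_two_one (b : Bool) :
    majOp (1 : Fin 2) b = placeGate (wire 0) σZ * placeGate (wire 1) (σ b) := by
  rw [majOp, show ((1 : Fin 2) : ℕ) = ((0 : Fin 2) : ℕ) + 1 from rfl, signDiag_wiresBelow_succ,
    Fin.val_zero, wiresBelow_zero, signDiag_empty, Matrix.one_mul]

/-- **Block reduction of the Majoranas of two adjacent wires**: for `o ∈ {0, 1}`,
`c_{(j+o), b} = Z_{<j} · (c^{(2)}_{o, b})_{[j, j+1]}` — the JW string below the block times the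
placement on the block of the corresponding TWO-qubit Majorana. [cite: JozsaMiyake2008, §5 (the initial Z operators are eliminated in all quadratic products)] -/
theorem majOp_block (j : ℕ) (h : j + 2 ≤ N) (o : Fin 2) (b : Bool) :
    majOp (blockEmb j h o) b = signDiag (wiresBelow j) * placeGate (blockEmb j h) (majOp o b) := by
  fin_cases o
  · show majOp (⟨j, by omega⟩ : Fin N) b = signDiag (wiresBelow j) * placeGate (blockEmb j h) (majOp 0 b)
    rw [majOp_two_zero, placeGate_nested, wire_zero_trans_blockEmb]
    rfl
  · show majOp (⟨j + 1, by omega⟩ : Fin N) b =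
      signDiag (wiresBelow j) * placeGate (blockEmb j h) (majOp 1 b)
    rw [majOp_two_one, placeGate_mul_holds, placeGate_nested, placeGate_nested,
      wire_zero_trans_blockEmb, wire_one_trans_blockEmb, ← Matrix.mul_assoc,
      ← signDiag_wiresBelow_succ' j (by omega)]
    rfl

/-- The two-qubit parity sign `Z ⊗ Z` (the full sign diagonal of `QReg 2`). [folklore] -/
noncomputable abbrev zz : Matrix (QReg 2) (QReg 2) ℂ := signDiag (univ : Finset (Fin 2))

/-- The wires of a block are `{j, j+1}` and its sign diagonal is the placed `Z ⊗ Z`. [folklore] -/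
theorem signDiag_blockWires (j : ℕ) (h : j + 2 ≤ N) :
    signDiag ((univ : Finset (Fin 2)).map (blockEmb j h)) = placeGate (blockEmb j h) zz :=
  signDiag_map _

/-- The JW string below a wire `j' ≥ j + 2` splits along the block `{j, j+1}`:
`Z_{<j'} = Z_{<j} · (Z_j Z_{j+1}) · Z_{[j+2, j')}`. [folklore] -/
theorem signDiag_wiresBelow_split (j : ℕ) (h : j + 2 ≤ N) (j' : ℕ) (hj' : j + 2 ≤ j') :
    signDiag (wiresBelow j' : Finset (Fin N)) =
      signDiag (wiresBelow j) * placeGate (blockEmb j h) zz *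
        signDiag (univ.filter fun i : Fin N => j + 2 ≤ (i : ℕ) ∧ (i : ℕ) < j') := by
  rw [← signDiag_blockWires, ← signDiag_union, ← signDiag_union]
  · congr 1
    ext i
    simp only [mem_wiresBelow, mem_union, mem_map, mem_univ, true_and, mem_filter]
    constructor
    · intro hi
      by_cases h1 : (i : ℕ) < j
      · exact Or.inl (Or.inl h1)
      · by_cases h2 : j + 2 ≤ (i : ℕ)
        · exact Or.inr ⟨h2, hi⟩
        · refine Or.inl (Or.inr ⟨⟨(i : ℕ) - j, by omega⟩, Fin.ext ?_⟩)
          simp only [blockEmb_apply_val]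
          omega
    · rintro ((h1 | ⟨a, rfl⟩) | ⟨_, h3⟩)
      · omega
      · simp only [blockEmb_apply_val]; omega
      · exact h3
  · rw [disjoint_left]
    rintro i hi hi'
    simp only [mem_union, mem_wiresBelow, mem_map, mem_univ, true_and] at hi
    simp only [mem_filter, mem_univ, true_and] at hi'
    rcases hi with hi | ⟨a, rfl⟩
    · omega
    · simp only [blockEmb_apply_val] at hi'; omega
  · rw [disjoint_left]
    rintro i hi hi'
    simp only [mem_wiresBelow] at hi
    simp only [mem_map, mem_univ, true_and] at hi'
    obtain ⟨a, rfl⟩ := hi'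
    simp only [blockEmb_apply_val] at hi
    omega

/-- **A placed two-qubit gate commuting with `Z ⊗ Z` commutes with the Majoranas of the wires
below its block.** [cite: JozsaMiyake2008, §5] -/
theorem placeGate_blockEmb_comm_majOp_of_lt (j : ℕ) (h : j + 2 ≤ N)
    (G : Matrix (QReg 2) (QReg 2) ℂ) (j' : Fin N) (hj' : (j' : ℕ) < j) (b : Bool) :
    placeGate (blockEmb j h) G * majOp j' b = majOp j' b * placeGate (blockEmb j h) G := by
  have hdisj : Disjoint (Set.range (blockEmb j h)) (Set.range (wire j')) := by
    rw [Set.disjoint_left]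
    rintro i ⟨a, rfl⟩ hi
    rw [range_wire, Set.mem_singleton_iff] at hi
    have := congrArg Fin.val hi
    simp only [blockEmb_apply_val] at this
    omega
  have hS : ∀ i ∈ (wiresBelow (j' : ℕ) : Finset (Fin N)), i ∉ Set.range (blockEmb j h) := by
    rintro i hi ⟨a, rfl⟩
    simp only [mem_wiresBelow, blockEmb_apply_val] at hi
    omega
  rw [majOp, ← Matrix.mul_assoc, ← signDiag_mul_placeGate_comm _ hS, Matrix.mul_assoc,
    placeGate_comm_of_disjoint_holds _ _ hdisj, Matrix.mul_assoc]

/-- **A placed two-qubit gate commuting with `Z ⊗ Z` commutes with the Majoranas of the wires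
above its block** (their JW strings contain `Z_j Z_{j+1}`). [cite: JozsaMiyake2008, §5] -/
theorem placeGate_blockEmb_comm_majOp_of_gt (j : ℕ) (h : j + 2 ≤ N)
    {G : Matrix (QReg 2) (QReg 2) ℂ} (hG : G * zz = zz * G) (j' : Fin N) (hj' : j + 2 ≤ (j' : ℕ))
    (b : Bool) :
    placeGate (blockEmb j h) G * majOp j' b = majOp j' b * placeGate (blockEmb j h) G := by
  have hdisj : Disjoint (Set.range (blockEmb j h)) (Set.range (wire j')) := by
    rw [Set.disjoint_left]
    rintro i ⟨a, rfl⟩ hi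
    rw [range_wire, Set.mem_singleton_iff] at hi
    have := congrArg Fin.val hi
    simp only [blockEmb_apply_val] at this
    omega
  have hS : ∀ i ∈ (wiresBelow j : Finset (Fin N)), i ∉ Set.range (blockEmb j h) := by
    rintro i hi ⟨a, rfl⟩
    simp only [mem_wiresBelow, blockEmb_apply_val] at hi
    omega
  have hT : ∀ i ∈ (univ.filter fun i : Fin N => j + 2 ≤ (i : ℕ) ∧ (i : ℕ) < j'),
      i ∉ Set.range (blockEmb j h) := by
    rintro i hi ⟨a, rfl⟩
    simp only [mem_filter, mem_univ, true_and, blockEmb_apply_val] at hi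
    omega
  have hzz : placeGate (blockEmb j h) G * placeGate (blockEmb j h) zz =
      placeGate (blockEmb j h) zz * placeGate (blockEmb j h) G := by
    rw [← placeGate_mul_holds, hG, placeGate_mul_holds]
  rw [majOp, signDiag_wiresBelow_split j h j' hj']
  simp only [← Matrix.mul_assoc]
  rw [← signDiag_mul_placeGate_comm _ hS, Matrix.mul_assoc (signDiag _), hzz,
    ← Matrix.mul_assoc, Matrix.mul_assoc _ (placeGate _ G), ← signDiag_mul_placeGate_comm _ hT,
    ← Matrix.mul_assoc, Matrix.mul_assoc _ (placeGate _ G),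
    placeGate_comm_of_disjoint_holds _ _ hdisj, ← Matrix.mul_assoc]

/-- The local Majorana index type of a two-qubit block: (wire offset, type `X`/`Y`). [folklore] -/
abbrev LIdx : Type := Fin 2 × Bool

/-! ### The four matrices and the Pauli expansion -/

/-- The four `2 × 2` matrices `α_{(0,X)} = X`, `α_{(0,Y)} = Y`, `α_{(1,X)} = Z`, `α_{(1,Y)} = -i·1`
(the odd-to-even parity blocks of the two-qubit Majoranas `X⊗1, Y⊗1, Z⊗X, Z⊗Y`).
[cite: JozsaMiyake2008, §5] -/
def pauli : LIdx → Matrix (Fin 2) (Fin 2) ℂ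
  | (0, false) => !![0, 1; 1, 0]
  | (0, true) => !![0, -I; I, 0]
  | (1, false) => !![1, 0; 0, -1]
  | (1, true) => !![-I, 0; 0, -I]

/-- Sums over the local index type. [folklore] -/
theorem sum_lIdx {M : Type*} [AddCommMonoid M] (f : LIdx → M) :
    ∑ p, f p = f (0, false) + f (0, true) + f (1, false) + f (1, true) := by
  rw [Fintype.sum_prod_type, Fin.sum_univ_two, Fintype.sum_bool, Fintype.sum_bool]
  abel

/-- The four local indices. [folklore] -/
theorem lIdx_cases (p : LIdx) : p = (0, false) ∨ p = (0, true) ∨ p = (1, false) ∨ p = (1, true) := by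
  obtain ⟨o, b⟩ := p
  fin_cases o <;> cases b <;> decide

/-- The Pauli coefficient `½ Tr(M αᴴ)`. [folklore] -/
noncomputable def coef (M : Matrix (Fin 2) (Fin 2) ℂ) (p : LIdx) : ℂ := (M * (pauli p)ᴴ).trace / 2

/-- The conjugate transpose of an explicit `2 × 2` matrix. [folklore] -/
theorem conjTranspose_fin_two (a b c d : ℂ) :
    (!![a, b; c, d])ᴴ = !![star a, star c; star b, star d] := by
  ext i j; fin_cases i <;> fin_cases j <;> simp

/-- The four coefficients of `M = [[a, b], [c, d]]`. [folklore] -/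
theorem coef_apply (M : Matrix (Fin 2) (Fin 2) ℂ) :
    coef M (0, false) = (M 0 1 + M 1 0) / 2 ∧ coef M (0, true) = (I * M 0 1 - I * M 1 0) / 2 ∧
      coef M (1, false) = (M 0 0 - M 1 1) / 2 ∧ coef M (1, true) = (I * M 0 0 + I * M 1 1) / 2 := by
  refine ⟨?_, ?_, ?_, ?_⟩ <;>
  · rw [coef, Matrix.eta_fin_two M, pauli, conjTranspose_fin_two, Matrix.mul_fin_two,
      trace_fin_two]
    simp <;> ring

/-- **Pauli expansion**: every `2 × 2` complex matrix is `∑_p coef M p · α_p`. [folklore] -/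
theorem eq_sum_coef_smul_pauli (M : Matrix (Fin 2) (Fin 2) ℂ) : M = ∑ p, coef M p • pauli p := by
  obtain ⟨h1, h2, h3, h4⟩ := coef_apply M
  rw [sum_lIdx, h1, h2, h3, h4]
  rw [Matrix.eta_fin_two M]
  simp only [pauli, smul_of, of_add_of]
  ext i j
  fin_cases i <;> fin_cases j <;> simp <;> ring_nf <;> simp [Complex.I_sq] <;> ring

/-- **Parseval** for the Pauli basis: `∑_p coef M p · conj (coef N p) = ½ Tr(M Nᴴ)`. [folklore] -/
theorem sum_coef_mul_star_coef (M N : Matrix (Fin 2) (Fin 2) ℂ) :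
    ∑ p, coef M p * star (coef N p) = (M * Nᴴ).trace / 2 := by
  obtain ⟨h1, h2, h3, h4⟩ := coef_apply M
  obtain ⟨k1, k2, k3, k4⟩ := coef_apply N
  rw [sum_lIdx, h1, h2, h3, h4, k1, k2, k3, k4, Matrix.eta_fin_two M, Matrix.eta_fin_two N,
    conjTranspose_fin_two, Matrix.mul_fin_two, trace_fin_two]
  simp
  ring_nf
  simp [Complex.I_sq]
  ring

/-- Orthogonality of the four matrices: `½ Tr(α_p α_qᴴ) = [p = q]`. [folklore] -/
theorem coef_pauli (p q : LIdx) : coef (pauli p) q = if p = q then 1 else 0 := by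
  obtain ⟨h1, h2, h3, h4⟩ := coef_apply (pauli p)
  rcases lIdx_cases p with rfl | rfl | rfl | rfl <;> rcases lIdx_cases q with rfl | rfl | rfl | rfl <;>
    simp only [h1, h2, h3, h4] <;> simp [pauli]

/-! ### The anti-quaternion space -/

/-- `M` is an **anti-quaternion** (`M ∈ -i·ℍ = span_ℝ {X, Y, Z, -i·1}`) if `Mᴴ = -adj M`.
[folklore] -/
def IsAntiQuat (M : Matrix (Fin 2) (Fin 2) ℂ) : Prop := Mᴴ = -M.adjugate

/-- Entry form of `IsAntiQuat`: `M₁₁ = -conj M₀₀` and `M₁₀ = conj M₀₁`. [folklore] -/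
theorem isAntiQuat_iff (M : Matrix (Fin 2) (Fin 2) ℂ) :
    IsAntiQuat M ↔ M 1 1 = -starRingEnd ℂ (M 0 0) ∧ M 1 0 = starRingEnd ℂ (M 0 1) := by
  rw [IsAntiQuat, adjugate_fin_two, Matrix.eta_fin_two Mᴴ]
  simp only [conjTranspose_apply]
  constructor
  · intro h
    have h00 := congrFun (congrFun h 0) 0
    have h10 := congrFun (congrFun h 1) 0
    simp at h00 h10
    exact ⟨by linear_combination h00, h10.symm⟩
  · rintro ⟨h11, h10⟩
    ext i j
    fin_cases i <;> fin_cases j <;> simp [h11, h10]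

/-- The four matrices are anti-quaternions. [folklore] -/
theorem isAntiQuat_pauli (p : LIdx) : IsAntiQuat (pauli p) := by
  rw [isAntiQuat_iff]
  rcases lIdx_cases p with rfl | rfl | rfl | rfl <;> simp [pauli]

/-- **The Pauli coefficients of an anti-quaternion are real.** [folklore] -/
theorem IsAntiQuat.star_coef {M : Matrix (Fin 2) (Fin 2) ℂ} (h : IsAntiQuat M) (p : LIdx) :
    star (coef M p) = coef M p := by
  obtain ⟨h11, h10⟩ := (isAntiQuat_iff M).1 h
  obtain ⟨h1, h2, h3, h4⟩ := coef_apply M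
  rcases lIdx_cases p with rfl | rfl | rfl | rfl <;> simp [h1, h2, h3, h4, h11, h10] <;> ring

/-- For a unitary matrix, `adj U = det U · Uᴴ`. [folklore] -/
theorem adjugate_eq_of_mem_unitaryGroup {U : Matrix (Fin 2) (Fin 2) ℂ}
    (hU : U ∈ Matrix.unitaryGroup (Fin 2) ℂ) : U.adjugate = U.det • Uᴴ := by
  have h1 : star U * U = 1 := Matrix.mem_unitaryGroup_iff'.1 hU
  rw [star_eq_conjTranspose] at h1
  calc U.adjugate = (Uᴴ * U) * U.adjugate := by rw [h1, Matrix.one_mul]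
    _ = Uᴴ * (U * U.adjugate) := by rw [Matrix.mul_assoc]
    _ = U.det • Uᴴ := by rw [mul_adjugate, Matrix.mul_smul, Matrix.mul_one]

/-- For a unitary matrix, `det U · conj (det U) = 1`. [folklore] -/
theorem det_mul_star_det_of_mem_unitaryGroup {U : Matrix (Fin 2) (Fin 2) ℂ}
    (hU : U ∈ Matrix.unitaryGroup (Fin 2) ℂ) : U.det * star U.det = 1 := by
  have h1 : U * star U = 1 := Matrix.mem_unitaryGroup_iff.1 hU
  rw [star_eq_conjTranspose] at h1
  have := congrArg Matrix.det h1
  rwa [det_mul, det_conjTranspose, det_one] at this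

/-- **Conjugation by an allowable pair preserves anti-quaternions**: for unitary `A, B` with
`det A = det B`, `Aᴴ M B ∈ -i·ℍ` whenever `M ∈ -i·ℍ` (this is where "allowable" enters:
`adj (Aᴴ M B) = det B · conj(det A) · Bᴴ adj(M) A`). [cite: JozsaMiyake2008, §1 (allowable G(A,B): det A = det B) and §5] -/
theorem IsAntiQuat.conj {A B M : Matrix (Fin 2) (Fin 2) ℂ} (hA : A ∈ Matrix.unitaryGroup (Fin 2) ℂ)
    (hB : B ∈ Matrix.unitaryGroup (Fin 2) ℂ) (hdet : A.det = B.det) (hM : IsAntiQuat M) :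
    IsAntiQuat (Aᴴ * M * B) := by
  unfold IsAntiQuat at hM ⊢
  have hs : B.det * star A.det = 1 := by rw [← hdet]; exact det_mul_star_det_of_mem_unitaryGroup hA
  have hs' : star A.det * B.det = 1 := by rw [mul_comm]; exact hs
  have h1 : (Aᴴ * M * B)ᴴ = -(Bᴴ * (M.adjugate * A)) := by
    rw [conjTranspose_mul, conjTranspose_mul, conjTranspose_conjTranspose, hM, Matrix.neg_mul,
      Matrix.mul_neg]
  have h2 : (Aᴴ * M * B).adjugate = Bᴴ * (M.adjugate * A) := by
    rw [adjugate_mul_distrib, adjugate_mul_distrib, ← adjugate_conjTranspose,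
      adjugate_eq_of_mem_unitaryGroup hA, adjugate_eq_of_mem_unitaryGroup hB, conjTranspose_smul,
      conjTranspose_conjTranspose]
    simp only [Matrix.mul_smul, Matrix.smul_mul, smul_smul, hs', one_smul]
  rw [h1, h2]

/-! ### The rotation of an allowable pair -/

/-- **The `SO(4)` image of the allowable pair `(A, B)`** on the block's four Majoranas:
`R_{μν} = Re ½Tr(Aᴴ α_μ B α_νᴴ)`. [cite: JozsaMiyake2008, Thm 3] -/
noncomputable def rot2 (A B : Matrix (Fin 2) (Fin 2) ℂ) : Matrix LIdx LIdx ℝ :=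
  Matrix.of fun μ ν => (coef (Aᴴ * pauli μ * B) ν).re

/-- The coefficients `½Tr(Aᴴ α_μ B α_νᴴ)` of an allowable pair are real. [cite: JozsaMiyake2008, Thm 3] -/
theorem rot2_coe {A B : Matrix (Fin 2) (Fin 2) ℂ} (hA : A ∈ Matrix.unitaryGroup (Fin 2) ℂ)
    (hB : B ∈ Matrix.unitaryGroup (Fin 2) ℂ) (hdet : A.det = B.det) (μ ν : LIdx) :
    ((rot2 A B μ ν : ℝ) : ℂ) = coef (Aᴴ * pauli μ * B) ν := by
  rw [rot2, of_apply]
  exact conj_eq_iff_re.1 (((isAntiQuat_pauli μ).conj hA hB hdet).star_coef ν)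

/-- **Jozsa–Miyake's Theorem 3 for one allowable `G(A,B)`, block form**:
`Aᴴ α_μ B = ∑_ν R_{μν} α_ν` with the REAL matrix `R = rot2 A B`. [cite: JozsaMiyake2008, Thm 3 and §5] -/
theorem conjPauli_eq_sum {A B : Matrix (Fin 2) (Fin 2) ℂ} (hA : A ∈ Matrix.unitaryGroup (Fin 2) ℂ)
    (hB : B ∈ Matrix.unitaryGroup (Fin 2) ℂ) (hdet : A.det = B.det) (μ : LIdx) :
    Aᴴ * pauli μ * B = ∑ ν, ((rot2 A B μ ν : ℝ) : ℂ) • pauli ν := by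
  conv_lhs => rw [eq_sum_coef_smul_pauli (Aᴴ * pauli μ * B)]
  exact sum_congr rfl fun ν _ => by rw [rot2_coe hA hB hdet]

/-- The same for the adjoint blocks: `Bᴴ α_μᴴ A = ∑_ν R_{μν} α_νᴴ`. [cite: JozsaMiyake2008, Thm 3 and §5] -/
theorem conjPauli_eq_sum' {A B : Matrix (Fin 2) (Fin 2) ℂ} (hA : A ∈ Matrix.unitaryGroup (Fin 2) ℂ)
    (hB : B ∈ Matrix.unitaryGroup (Fin 2) ℂ) (hdet : A.det = B.det) (μ : LIdx) :
    Bᴴ * (pauli μ)ᴴ * A = ∑ ν, ((rot2 A B μ ν : ℝ) : ℂ) • (pauli ν)ᴴ := by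
  have h := congrArg conjTranspose (conjPauli_eq_sum hA hB hdet μ)
  rw [conjTranspose_mul, conjTranspose_mul, conjTranspose_conjTranspose, conjTranspose_sum,
    ← Matrix.mul_assoc] at h
  rw [h]
  exact sum_congr rfl fun ν _ => by rw [conjTranspose_smul, Complex.star_def, conj_ofReal]

/-- **The rotation of an allowable pair is orthogonal**: `R Rᵀ = 1` (Parseval plus unitarity of
`A` and `B`). [cite: JozsaMiyake2008, Thm 3 (R ∈ SO(2n))] -/
theorem rot2_mul_transpose {A B : Matrix (Fin 2) (Fin 2) ℂ} (hA : A ∈ Matrix.unitaryGroup (Fin 2) ℂ)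
    (hB : B ∈ Matrix.unitaryGroup (Fin 2) ℂ) (hdet : A.det = B.det) :
    rot2 A B * (rot2 A B)ᵀ = 1 := by
  have hA' : A * Aᴴ = 1 := by
    have := Matrix.mem_unitaryGroup_iff.1 hA; rwa [star_eq_conjTranspose] at this
  have hB' : B * Bᴴ = 1 := by
    have := Matrix.mem_unitaryGroup_iff.1 hB; rwa [star_eq_conjTranspose] at this
  ext μ μ'
  apply Complex.ofReal_injective
  rw [Matrix.mul_apply]
  push_cast
  have key : ∑ ν, ((rot2 A B μ ν : ℝ) : ℂ) * ((rot2 A B)ᵀ ν μ' : ℝ) =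
      ∑ ν, coef (Aᴴ * pauli μ * B) ν * star (coef (Aᴴ * pauli μ' * B) ν) := by
    refine sum_congr rfl fun ν _ => ?_
    rw [transpose_apply, rot2_coe hA hB hdet, rot2_coe hA hB hdet,
      ((isAntiQuat_pauli μ').conj hA hB hdet).star_coef ν]
  rw [key, sum_coef_mul_star_coef, conjTranspose_mul, conjTranspose_mul,
    conjTranspose_conjTranspose]
  have htr : (Aᴴ * pauli μ * B * (Bᴴ * ((pauli μ')ᴴ * A))).trace = (pauli μ * (pauli μ')ᴴ).trace := by
    rw [show Aᴴ * pauli μ * B * (Bᴴ * ((pauli μ')ᴴ * A)) =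
        Aᴴ * (pauli μ * (B * Bᴴ) * (pauli μ')ᴴ) * A by simp only [Matrix.mul_assoc],
      hB', Matrix.mul_one, trace_mul_cycle, hA', Matrix.one_mul]
  rw [htr, show (pauli μ * (pauli μ')ᴴ).trace / 2 = coef (pauli μ) μ' from rfl, coef_pauli,
    Matrix.one_apply]
  split_ifs <;> simp

/-- Entries of an orthogonal real matrix are bounded by `1`. [folklore] -/
theorem abs_le_one_of_mul_transpose {ι : Type*} [Fintype ι] [DecidableEq ι] {R : Matrix ι ι ℝ}
    (h : R * Rᵀ = 1) (μ ν : ι) : |R μ ν| ≤ 1 := by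
  have hrow : ∑ ν', R μ ν' * R μ ν' = 1 := by
    have := congrFun (congrFun h μ) μ
    rwa [Matrix.mul_apply, Matrix.one_apply_eq] at this
  have hle : R μ ν * R μ ν ≤ ∑ ν', R μ ν' * R μ ν' :=
    single_le_sum (f := fun ν' => R μ ν' * R μ ν') (fun i _ => mul_self_nonneg _) (mem_univ ν)
  rw [hrow] at hle
  exact abs_le_one_iff_mul_self_le_one.2 hle

/-! ### Labels of a two-qubit register and the parity split -/

/-- The bit of a block index: `0 ↦ false`, `1 ↦ true`. [folklore] -/
def toBit (r : Fin 2) : Bool := decide (r = 1)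

/-- The basis label `|a b⟩` of a two-qubit register (`x 0 = a`, `x 1 = b`). [folklore] -/
def ket (a b : Bool) : QReg 2 := ![a, b]

/-- Every two-qubit label is a `ket`. [folklore] -/
theorem eq_ket (x : QReg 2) : x = ket (x 0) (x 1) := by
  ext i; fin_cases i <;> rfl

/-- Sums over two-qubit labels. [folklore] -/
theorem sum_qReg_two {M : Type*} [AddCommMonoid M] (f : QReg 2 → M) :
    ∑ x, f x = f (ket false false) + f (ket false true) + f (ket true false) + f (ket true true) := by
  rw [← (finTwoArrowEquiv Bool).symm.sum_comp, Fintype.sum_prod_type]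
  simp only [Fintype.sum_bool, finTwoArrowEquiv, Equiv.coe_fn_symm_mk]
  change f (ket true true) + f (ket true false) + (f (ket false true) + f (ket false false)) = _
  abel

/-- **The parity split** `QReg 2 ≃ Fin 2 ⊕ Fin 2`: even-parity labels `|00⟩, |11⟩ ↦ inl 0, inl 1`
and odd-parity labels `|01⟩, |10⟩ ↦ inr 0, inr 1` (within each block the index is the first bit,
the basis order of JM08 eq. (1) and of `gateGAB`). [cite: JozsaMiyake2008, §1 eq. (1)] -/
def paritySplit : QReg 2 ≃ Fin 2 ⊕ Fin 2 where
  toFun x := if x 0 = x 1 then Sum.inl (if x 0 then 1 else 0) else Sum.inr (if x 0 then 1 else 0)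
  invFun s := match s with
    | Sum.inl r => ket (toBit r) (toBit r)
    | Sum.inr r => ket (toBit r) (!toBit r)
  left_inv := by unfold Function.LeftInverse; decide
  right_inv := by unfold Function.RightInverse Function.LeftInverse; decide

/-- The inverse parity split on even indices. [folklore] -/
@[simp] theorem paritySplit_symm_inl (r : Fin 2) : paritySplit.symm (Sum.inl r) = ket (toBit r) (toBit r) := rfl

/-- The inverse parity split on odd indices. [folklore] -/
@[simp] theorem paritySplit_symm_inr (r : Fin 2) : paritySplit.symm (Sum.inr r) = ket (toBit r) (!toBit r) := rfl

/-- **`G(A,B)` is `A ⊕ B` in the parity-sorted basis.** [cite: JozsaMiyake2008, §1 eq. (1)] -/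
theorem reindex_gateGAB (A B : Matrix (Fin 2) (Fin 2) ℂ) :
    reindex paritySplit paritySplit (gateGAB A B) = fromBlocks A 0 0 B := by
  ext (i | i) (j | j) <;> fin_cases i <;> fin_cases j <;>
    simp [gateGAB, ket, toBit]

/-! ### Entries of the two-qubit Majoranas -/

/-- **Entries of a Majorana operator**: the JW sign of the label below `j`, times the Pauli entry
on wire `j`, provided the labels agree off `j`. [cite: JozsaMiyake2008, §5 eq. (11)] -/
theorem majOp_apply (j : Fin N) (b : Bool) (x y : QReg N) :
    majOp j b x y = (∏ i ∈ wiresBelow (j : ℕ), bsign (x i)) *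
      if (∀ i, i ≠ j → x i = y i) then σ b (fun _ => x j) (fun _ => y j) else 0 := by
  rw [majOp, signDiag, diagonal_mul, placeGate_apply]
  simp only [range_wire, Set.mem_singleton_iff]
  rfl

/-- Entries of `σ_b` on constant one-qubit labels. [folklore] -/
theorem σ_apply_const (b a c : Bool) :
    σ b (fun _ : Fin 1 => a) (fun _ => c) = if a = c then 0 else if b then (if a then I else -I) else 1 := by
  cases b <;> simp [σ, σX, σY]

/-- Entries of the Majoranas of wire `0` of a two-qubit register. [folklore] -/
theorem majOp_two_zero_apply (b : Bool) (x y : QReg 2) :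
    majOp 0 b x y = if x 1 = y 1 then σ b (fun _ => x 0) (fun _ => y 0) else 0 := by
  rw [majOp_apply, Fin.val_zero, wiresBelow_zero, prod_empty, one_mul]
  have h : (∀ i : Fin 2, i ≠ 0 → x i = y i) ↔ x 1 = y 1 := by
    rw [Fin.forall_fin_two]; simp
  simp only [h]

/-- Entries of the Majoranas of wire `1` of a two-qubit register. [folklore] -/
theorem majOp_two_one_apply (b : Bool) (x y : QReg 2) :
    majOp 1 b x y = bsign (x 0) * if x 0 = y 0 then σ b (fun _ => x 1) (fun _ => y 1) else 0 := by
  rw [majOp_apply]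
  have h1 : (wiresBelow ((1 : Fin 2) : ℕ) : Finset (Fin 2)) = {0} := by decide
  have h : (∀ i : Fin 2, i ≠ 1 → x i = y i) ↔ x 0 = y 0 := by
    rw [Fin.forall_fin_two]; simp
  rw [h1, prod_singleton]
  simp only [h]

/-- **The two-qubit Majoranas in the parity-sorted basis**: `c_{(o,b)} = [[0, α], [αᴴ, 0]]` with
`α = pauli (o, b) ∈ {X, Y, Z, -i·1}`. [cite: JozsaMiyake2008, §5] -/
theorem reindex_majOp (p : LIdx) :
    reindex paritySplit paritySplit (majOp p.1 p.2) = fromBlocks 0 (pauli p) (pauli p)ᴴ 0 := by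
  rcases lIdx_cases p with rfl | rfl | rfl | rfl <;> ext (i | i) (j | j) <;> fin_cases i <;> fin_cases j <;>
    simp [majOp_two_zero_apply, majOp_two_one_apply, σ_apply_const, ket, toBit, pauli, bsign,
      conjTranspose_fin_two]

/-- A scalar combination of the reindexed Majoranas is block anti-diagonal. [folklore] -/
theorem sum_smul_fromBlocks (s : Finset LIdx) (c : LIdx → ℂ) :
    ∑ ν ∈ s, c ν • fromBlocks (0 : Matrix (Fin 2) (Fin 2) ℂ) (pauli ν) (pauli ν)ᴴ 0 =
      fromBlocks 0 (∑ ν ∈ s, c ν • pauli ν) (∑ ν ∈ s, c ν • (pauli ν)ᴴ) 0 := by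
  classical
  induction s using Finset.induction_on with
  | empty => simp
  | insert a s ha ih =>
    rw [sum_insert ha, sum_insert ha, sum_insert ha, ih, fromBlocks_smul, fromBlocks_add]
    simp

/-! ### The rotation of an allowable two-qubit gate -/

/-- The even-parity block of a two-qubit gate (basis `|00⟩, |11⟩`). [cite: JozsaMiyake2008, §1 eq. (1)] -/
def evenBlock (U : Matrix (QReg 2) (QReg 2) ℂ) : Matrix (Fin 2) (Fin 2) ℂ :=
  Matrix.of fun r c => U (ket (toBit r) (toBit r)) (ket (toBit c) (toBit c))

/-- The odd-parity block of a two-qubit gate (basis `|01⟩, |10⟩`). [cite: JozsaMiyake2008, §1 eq. (1)] -/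
def oddBlock (U : Matrix (QReg 2) (QReg 2) ℂ) : Matrix (Fin 2) (Fin 2) ℂ :=
  Matrix.of fun r c => U (ket (toBit r) (!toBit r)) (ket (toBit c) (!toBit c))

/-- The even block of `G(A,B)` is `A`. [cite: JozsaMiyake2008, §1 eq. (1)] -/
@[simp] theorem evenBlock_gateGAB (A B : Matrix (Fin 2) (Fin 2) ℂ) : evenBlock (gateGAB A B) = A := by
  ext i j; fin_cases i <;> fin_cases j <;> simp [evenBlock, gateGAB, ket, toBit]

/-- The odd block of `G(A,B)` is `B`. [cite: JozsaMiyake2008, §1 eq. (1)] -/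
@[simp] theorem oddBlock_gateGAB (A B : Matrix (Fin 2) (Fin 2) ℂ) : oddBlock (gateGAB A B) = B := by
  ext i j; fin_cases i <;> fin_cases j <;> simp [oddBlock, gateGAB, ket, toBit]

/-- **The real `4 × 4` matrix of a two-qubit gate on the block Majoranas**,
`rotOf U = rot2 (evenBlock U) (oddBlock U)`; for an allowable `G(A,B)` this is its `SO(4)` image
(JM08 Thm. 3). [cite: JozsaMiyake2008, Thm 3] -/
noncomputable def rotOf (U : Matrix (QReg 2) (QReg 2) ℂ) : Matrix LIdx LIdx ℝ :=
  rot2 (evenBlock U) (oddBlock U)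

/-- **Jozsa–Miyake's Theorem 3 for one allowable `G(A,B)` on two qubits**:
`Uᴴ c_μ U = ∑_ν (rotOf U)_{μν} c_ν` for the four Majoranas `c_{(o,b)} = majOp o b` of `QReg 2`.
[cite: JozsaMiyake2008, Thm 3 and §5] -/
theorem IsMatchgate.conj_majOp {U : Matrix (QReg 2) (QReg 2) ℂ} (hU : IsMatchgate U) (μ : LIdx) :
    Uᴴ * majOp μ.1 μ.2 * U = ∑ ν, ((rotOf U μ ν : ℝ) : ℂ) • majOp ν.1 ν.2 := by
  obtain ⟨A, B, hA, hB, hdet, rfl⟩ := hU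
  rw [rotOf, evenBlock_gateGAB, oddBlock_gateGAB]
  apply (reindexAlgEquiv ℂ ℂ paritySplit).injective
  rw [map_mul, map_mul, map_sum]
  simp only [map_smul, coe_reindexAlgEquiv]
  rw [← conjTranspose_reindex, reindex_gateGAB, reindex_majOp]
  simp_rw [reindex_majOp]
  rw [sum_smul_fromBlocks, fromBlocks_conjTranspose, fromBlocks_multiply, fromBlocks_multiply,
    ← conjPauli_eq_sum hA hB hdet, ← conjPauli_eq_sum' hA hB hdet]
  simp [Matrix.mul_assoc]

/-- The rotation of an allowable gate is orthogonal. [cite: JozsaMiyake2008, Thm 3] -/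
theorem IsMatchgate.rotOf_mul_transpose {U : Matrix (QReg 2) (QReg 2) ℂ} (hU : IsMatchgate U) :
    rotOf U * (rotOf U)ᵀ = 1 := by
  obtain ⟨A, B, hA, hB, hdet, rfl⟩ := hU
  rw [rotOf, evenBlock_gateGAB, oddBlock_gateGAB]
  exact rot2_mul_transpose hA hB hdet

/-- Entries of the rotation of an allowable gate are at most `1` in absolute value. [folklore] -/
theorem IsMatchgate.abs_rotOf_le_one {U : Matrix (QReg 2) (QReg 2) ℂ} (hU : IsMatchgate U) (μ ν : LIdx) :
    |rotOf U μ ν| ≤ 1 :=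
  abs_le_one_of_mul_transpose hU.rotOf_mul_transpose μ ν

/-! ### Unitarity, parity and the swapped orientation -/

/-- Reindexing along an equivalence reflects unitarity. [folklore] -/
theorem mem_unitaryGroup_of_reindex {ι κ : Type*} [Fintype ι] [DecidableEq ι] [Fintype κ]
    [DecidableEq κ] (e : ι ≃ κ) {M : Matrix ι ι ℂ}
    (h : reindex e e M ∈ Matrix.unitaryGroup κ ℂ) : M ∈ Matrix.unitaryGroup ι ℂ := by
  have := submatrix_mem_unitaryGroup e h
  rwa [reindex_apply, submatrix_submatrix, Equiv.symm_comp_self, submatrix_id_id] at this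

/-- **Allowable matchgates are unitary.** [cite: JozsaMiyake2008, §1 eq. (1)] -/
theorem IsMatchgate.mem_unitaryGroup {U : Matrix (QReg 2) (QReg 2) ℂ} (hU : IsMatchgate U) :
    U ∈ Matrix.unitaryGroup (QReg 2) ℂ := by
  obtain ⟨A, B, hA, hB, -, rfl⟩ := hU
  refine mem_unitaryGroup_of_reindex paritySplit ?_
  rw [reindex_gateGAB, Matrix.mem_unitaryGroup_iff, star_eq_conjTranspose, fromBlocks_conjTranspose,
    fromBlocks_multiply]
  have hA' : A * Aᴴ = 1 := by
    have := Matrix.mem_unitaryGroup_iff.1 hA; rwa [star_eq_conjTranspose] at this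
  have hB' : B * Bᴴ = 1 := by
    have := Matrix.mem_unitaryGroup_iff.1 hB; rwa [star_eq_conjTranspose] at this
  simp [hA', hB']

/-- **Matchgates preserve parity**: `G(A,B)` commutes with `Z ⊗ Z`. [cite: JozsaMiyake2008, §1 (G(A,B) acts within the parity subspaces)] -/
theorem gateGAB_mul_zz (A B : Matrix (Fin 2) (Fin 2) ℂ) : gateGAB A B * zz = zz * gateGAB A B := by
  ext x y
  rw [zz, signDiag, mul_diagonal, diagonal_mul, eq_ket x, eq_ket y]
  cases x 0 <;> cases x 1 <;> cases y 0 <;> cases y 1 <;>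
    simp [gateGAB, ket, bsign, Fin.prod_univ_two]

/-- Allowable matchgates commute with `Z ⊗ Z`. [cite: JozsaMiyake2008, §1] -/
theorem IsMatchgate.mul_zz_comm {U : Matrix (QReg 2) (QReg 2) ℂ} (hU : IsMatchgate U) :
    U * zz = zz * U := by
  obtain ⟨A, B, -, -, -, rfl⟩ := hU
  exact gateGAB_mul_zz A B

/-- `X B X` for a `2 × 2` matrix `B` (rows and columns reversed). [folklore] -/
def revB (B : Matrix (Fin 2) (Fin 2) ℂ) : Matrix (Fin 2) (Fin 2) ℂ := !![B 1 1, B 1 0; B 0 1, B 0 0]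

/-- `revB B` is `B` reindexed along the swap of `Fin 2`. [folklore] -/
theorem revB_eq_submatrix (B : Matrix (Fin 2) (Fin 2) ℂ) :
    revB B = B.submatrix (Equiv.swap (0 : Fin 2) 1) (Equiv.swap (0 : Fin 2) 1) := by
  ext i j; fin_cases i <;> fin_cases j <;> simp [revB]

/-- The wire exchange of a two-qubit register. [folklore] -/
abbrev wireSwap : Fin 2 ≃ Fin 2 := Equiv.swap 0 1

/-- **Exchanging the two wires of `G(A,B)` gives `G(A, XBX)`** (`SWAP · G(A,B) · SWAP = G(A, XBX)`).
[cite: JozsaMiyake2008, §2 (proof of Thm 2: G(A,B) SWAP = SWAP G(A, XBX))] -/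
theorem gateGAB_submatrix_swap (A B : Matrix (Fin 2) (Fin 2) ℂ) :
    (gateGAB A B).submatrix (fun x => x ∘ wireSwap) (fun x => x ∘ wireSwap) = gateGAB A (revB B) := by
  ext x y
  rw [submatrix_apply, eq_ket x, eq_ket y]
  cases x 0 <;> cases x 1 <;> cases y 0 <;> cases y 1 <;>
    simp [gateGAB, ket, revB]

/-- **The swapped orientation of an allowable matchgate is an allowable matchgate.**
[cite: JozsaMiyake2008, §2 (SWAP G(A,B) SWAP = G(A, XBX) is again allowable)] -/
theorem IsMatchgate.submatrix_swap {U : Matrix (QReg 2) (QReg 2) ℂ} (hU : IsMatchgate U) :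
    IsMatchgate (U.submatrix (fun x => x ∘ wireSwap) (fun x => x ∘ wireSwap)) := by
  obtain ⟨A, B, hA, hB, hdet, rfl⟩ := hU
  refine ⟨A, revB B, hA, ?_, ?_, gateGAB_submatrix_swap A B⟩
  · rw [revB_eq_submatrix]
    exact submatrix_mem_unitaryGroup _ hB
  · rw [hdet, revB, det_fin_two, det_fin_two]
    simp
    ring

/-! ### Majorana indices and block-embedded rotations -/

/-- The index type of the `2N` Majoranas of `N` wires: (wire, type `X`/`Y`). [cite: JozsaMiyake2008, §5 eq. (11)] -/
abbrev MIdx (N : ℕ) : Type := Fin N × Bool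

/-- The wire `i` lies in the block `{j, j+1}`. [folklore] -/
def InBlock (j : ℕ) (i : Fin N) : Prop := j ≤ (i : ℕ) ∧ (i : ℕ) < j + 2

/-- Block membership is decidable. [folklore] -/
instance instDecidableInBlock (j : ℕ) (i : Fin N) : Decidable (InBlock j i) := by
  unfold InBlock; infer_instance

/-- The local index of a Majorana index relative to the block at `j` (meaningful in the block).
[folklore] -/
def locOf (j : ℕ) (p : MIdx N) : LIdx := (if (p.1 : ℕ) = j then 0 else 1, p.2)

/-- The global index of a local index of the block at `j`. [folklore] -/
def blockIdx (j : ℕ) (h : j + 2 ≤ N) : LIdx ↪ MIdx N :=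
  ⟨fun ν => (blockEmb j h ν.1, ν.2), fun a b hab => by
    simp only [Prod.mk.injEq] at hab
    exact Prod.ext ((blockEmb j h).injective hab.1) hab.2⟩

/-- `blockIdx` values. [folklore] -/
theorem blockIdx_apply (j : ℕ) (h : j + 2 ≤ N) (ν : LIdx) : blockIdx j h ν = (blockEmb j h ν.1, ν.2) := rfl

/-- The wire of a block index. [folklore] -/
@[simp] theorem blockIdx_fst (j : ℕ) (h : j + 2 ≤ N) (ν : LIdx) : (blockIdx j h ν).1 = blockEmb j h ν.1 := rfl

/-- The type of a block index. [folklore] -/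
@[simp] theorem blockIdx_snd (j : ℕ) (h : j + 2 ≤ N) (ν : LIdx) : (blockIdx j h ν).2 = ν.2 := rfl

/-- Block indices lie in the block. [folklore] -/
theorem inBlock_blockEmb (j : ℕ) (h : j + 2 ≤ N) (o : Fin 2) : InBlock j (blockEmb j h o) := by
  have := o.isLt
  simp only [InBlock, blockEmb_apply_val]
  omega

/-- `locOf` inverts `blockIdx`. [folklore] -/
@[simp] theorem locOf_blockIdx (j : ℕ) (h : j + 2 ≤ N) (ν : LIdx) : locOf j (blockIdx j h ν) = ν := by
  obtain ⟨o, b⟩ := ν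
  simp only [blockIdx_apply, locOf, blockEmb_apply_val, Prod.mk.injEq, and_true]
  fin_cases o <;> simp

/-- `blockIdx` inverts `locOf` on the block. [folklore] -/
theorem blockIdx_locOf {j : ℕ} (h : j + 2 ≤ N) {p : MIdx N} (hp : InBlock j p.1) :
    blockIdx j h (locOf j p) = p := by
  obtain ⟨i, b⟩ := p
  simp only [InBlock] at hp
  simp only [blockIdx_apply, locOf]
  refine Prod.ext (Fin.ext ?_) rfl
  simp only [blockEmb_apply_val]
  split_ifs with hi
  · simp [hi]
  · simp only [Fin.val_one]; omega

/-- The Majorana indices of the block are the image of `blockIdx`. [folklore] -/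
theorem filter_inBlock_eq_map (j : ℕ) (h : j + 2 ≤ N) :
    (univ.filter fun p : MIdx N => InBlock j p.1) = univ.map (blockIdx j h) := by
  ext p
  simp only [mem_filter, mem_univ, true_and, mem_map]
  constructor
  · intro hp; exact ⟨locOf j p, blockIdx_locOf h hp⟩
  · rintro ⟨ν, rfl⟩; exact inBlock_blockEmb j h ν.1

/-- Splitting a sum over Majorana indices into the block at `j` and the rest. [folklore] -/
theorem sum_mIdx_split {M : Type*} [AddCommMonoid M] (j : ℕ) (h : j + 2 ≤ N) (f : MIdx N → M) :
    ∑ p, f p = ∑ ν : LIdx, f (blockIdx j h ν) + ∑ p ∈ univ.filter (fun p : MIdx N => ¬ InBlock j p.1), f p := by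
  rw [← sum_filter_add_sum_filter_not univ (fun p : MIdx N => InBlock j p.1), filter_inBlock_eq_map j h,
    sum_map]

/-- **The block embedding of a `4 × 4` real matrix** at the wires `{j, j+1}`: `R` on the block's
four Majorana indices, the identity elsewhere (the `SO(2n)` matrix of one n.n. gate, JM08 §4).
[cite: JozsaMiyake2008, §4 (the SO(2n) matrix of an individual gate)] -/
def embE {K : Type*} [Zero K] [One K] (j : ℕ) (R : Matrix LIdx LIdx K) : Matrix (MIdx N) (MIdx N) K :=
  Matrix.of fun p q => if InBlock j p.1 ∧ InBlock j q.1 then R (locOf j p) (locOf j q)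
    else if p = q then 1 else 0

section embE

variable {K : Type*} [Zero K] [One K]

/-- Rows of `embE` off the block are unit vectors. [folklore] -/
theorem embE_of_not_inBlock {j : ℕ} (R : Matrix LIdx LIdx K) {p : MIdx N} (hp : ¬ InBlock j p.1) (q : MIdx N) :
    embE j R p q = if p = q then 1 else 0 := by
  simp [embE, hp]

/-- Columns of `embE` off the block are unit vectors. [folklore] -/
theorem embE_of_not_inBlock' {j : ℕ} (R : Matrix LIdx LIdx K) (p : MIdx N) {q : MIdx N} (hq : ¬ InBlock j q.1) :
    embE j R p q = if p = q then 1 else 0 := by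
  simp [embE, hq]

/-- `embE` from a block index into the block. [folklore] -/
theorem embE_blockIdx_of_inBlock (j : ℕ) (h : j + 2 ≤ N) (R : Matrix LIdx LIdx K) (μ : LIdx) {q : MIdx N}
    (hq : InBlock j q.1) : embE j R (blockIdx j h μ) q = R μ (locOf j q) := by
  simp [embE, inBlock_blockEmb, hq]

/-- `embE` on block indices. [folklore] -/
@[simp] theorem embE_blockIdx (j : ℕ) (h : j + 2 ≤ N) (R : Matrix LIdx LIdx K) (μ ν : LIdx) :
    embE j R (blockIdx j h μ) (blockIdx j h ν) = R μ ν := by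
  rw [embE_blockIdx_of_inBlock j h R μ (inBlock_blockEmb j h ν.1), locOf_blockIdx]

end embE

/-- **The sparse row update**: `(w E)_q = ∑_μ w_{(j+μ₁, μ₂)} R_{μ, loc q}` on the block, `w_q`
elsewhere. [cite: JozsaMiyake2008, §4] -/
theorem vecMul_embE_apply {K : Type*} [NonAssocSemiring K] (j : ℕ) (h : j + 2 ≤ N) (R : Matrix LIdx LIdx K)
    (w : MIdx N → K) (q : MIdx N) :
    (w ᵥ* embE j R) q = if InBlock j q.1 then ∑ μ : LIdx, w (blockIdx j h μ) * R μ (locOf j q) else w q := by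
  rw [vecMul, dotProduct]
  split_ifs with hq
  · rw [sum_mIdx_split j h, sum_eq_zero (s := univ.filter _), add_zero]
    · exact sum_congr rfl fun μ _ => by rw [embE_blockIdx_of_inBlock j h R μ hq]
    · intro p hp
      rw [mem_filter] at hp
      rw [embE_of_not_inBlock R hp.2, if_neg, mul_zero]
      rintro rfl; exact hp.2 hq
  · simp_rw [embE_of_not_inBlock' R _ hq, mul_ite, mul_one, mul_zero]
    rw [sum_ite_eq' univ q, if_pos (mem_univ q)]

/-- **The block embedding of an orthogonal matrix is orthogonal.** [cite: JozsaMiyake2008, Thm 3] -/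
theorem embE_mul_transpose (j : ℕ) (h : j + 2 ≤ N) {R : Matrix LIdx LIdx ℝ} (hR : R * Rᵀ = 1) :
    embE j R * (embE j R : Matrix (MIdx N) (MIdx N) ℝ)ᵀ = 1 := by
  ext p p'
  rw [Matrix.mul_apply, Matrix.one_apply]
  by_cases hp : InBlock j p.1
  · rw [sum_mIdx_split j h, sum_eq_zero (s := univ.filter _), add_zero]
    · by_cases hp' : InBlock j p'.1
      · have key : ∑ ν : LIdx, embE j R p (blockIdx j h ν) * (embE j R)ᵀ (blockIdx j h ν) p' =
            (R * Rᵀ) (locOf j p) (locOf j p') := by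
          rw [Matrix.mul_apply]
          refine sum_congr rfl fun ν _ => ?_
          rw [transpose_apply, transpose_apply, ← blockIdx_locOf h hp, ← blockIdx_locOf h hp']
          simp only [embE_blockIdx, locOf_blockIdx]
        rw [key, hR]
        by_cases hpp : p = p'
        · rw [if_pos hpp, hpp, Matrix.one_apply_eq]
        · rw [if_neg hpp, Matrix.one_apply_ne]
          intro hl; exact hpp (by rw [← blockIdx_locOf h hp, ← blockIdx_locOf h hp', hl])
      · rw [sum_eq_zero, if_neg]
        · rintro rfl; exact hp' hp
        · intro ν _
          rw [transpose_apply, embE_of_not_inBlock R hp', if_neg, mul_zero]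
          rintro rfl; exact hp' (inBlock_blockEmb j h ν.1)
    · intro q hq
      rw [mem_filter] at hq
      rw [embE_of_not_inBlock' R p hq.2, if_neg, zero_mul]
      rintro rfl; exact hq.2 hp
  · simp_rw [transpose_apply, embE_of_not_inBlock R hp, ite_mul, one_mul, zero_mul]
    rw [sum_ite_eq univ p, if_pos (mem_univ p)]
    by_cases hpp : p = p'
    · subst hpp; rw [embE_of_not_inBlock R hp]
    · rw [if_neg hpp, embE_of_not_inBlock' R p' hp, if_neg (Ne.symm hpp)]

/-- **The simulated quantity `⟨Z₀⟩` as a function of the two rows `(0,X), (0,Y)` of the total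
rotation** (JM08 eq. (10) evaluated on a basis input `x`):
`∑_i (-1)^{x_i} (v₀(i,X) v₁(i,Y) - v₀(i,Y) v₁(i,X))`. [cite: JozsaMiyake2008, §4 eq. (10)] -/
def zExp (x : QReg N) (v₀ v₁ : MIdx N → ℝ) : ℝ :=
  ∑ i : Fin N, (if x i then -1 else 1) * (v₀ (i, false) * v₁ (i, true) - v₀ (i, true) * v₁ (i, false))

end Literature.Computability.QuantumComplexity.Matchgate
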